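import Literature.IUT.HodgeTheaters.TemperedCoveringsProp24iiiByName
import Literature.IUT.HodgeTheaters.TemperedCoveringsProp24Sub
import HarnessLib

/-!
# [IUTchI] Prop. 2.4 (iii): the sub-DAG node `HasCompactProSigma` from a cusp with `I_x ≅ Ẑ(1)`, PROOFS

Mochizuki, *Inter-universal Teichmüller theory I*, kurims manuscript (May 2020), §2, proof of
Prop. 2.4 (iii), p. 51 [cite: Mochizuki2012, Prop 2.4(iii) p.51] (D-0012 claim key; series status
DISPUTED — nothing on this page is contested).  PROOF-ONLY glue (abc-iut-L5-t11; no definitions,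
nothing printed is asserted) between the SUB-DAG node `StableCurveTemperedData.HasCompactProSigma`
of `TemperedCoveringsProp24Sub` (abc-iut-w5-d119; plan/L5/SUBDAG-IUTchI-Prop24.md §C) — "a pro-`Σ`
Sylow subgroup … `⊆ Δ^tp_X`", in the elementary form consumed by `prop24iii_of_prop24i'` — and its
discharge BY NAME from "`I_x ≅ Ẑ(1)`" (`TemperedCoveringsProp24iiiByName`, route note there):
`hasCompactProSigma_of_equiv_zHat`; hence the sub-DAG capstone `Prop24Tower.prop24iii_of_tower` with
its last hypothesis discharged (`Prop24Tower.prop24iii_of_tower_of_equiv_zHat`).  Also the PER-CUSP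
strong form of the pro-`Σ` part of `I_x` (`proSigmaPart_of_equiv_zHat`: `Q ⊆ I_x` infinite compact
totally disconnected pro-`Σ`), which is the datum `hPx` of the [IUTchII] Cor. 2.4 (i) bridge
(`HodgeArakelov.PlusMinusTowerStableCurveBridgeH25Datum`, abc-iut-w5-d121).
-/

namespace Literature.IUT.HodgeTheaters

open Literature.AnabelianGeometry.SemiGraphs (IsProSigma)

namespace StableCurveTemperedData

universe u

variable (D : StableCurveTemperedData.{u})

/-- A space admitting a continuous injection into a totally disconnected space is totally
disconnected (private plumbing). [folklore] -/
private theorem totallyDisconnectedSpace_of_continuous_injective' {α β : Type*}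
    [TopologicalSpace α] [TopologicalSpace β] [TotallyDisconnectedSpace β] {f : α → β}
    (hf : Continuous f) (hinj : Function.Injective f) : TotallyDisconnectedSpace α :=
  ⟨isTotallyDisconnected_of_image hf.continuousOn hinj
      (isTotallyDisconnected_of_totallyDisconnectedSpace _)⟩

/-- **"The unique maximal pro-`Σ` subgroup of `I_x ≅ Ẑ(1)`", PER-CUSP strong form** (p. 51): if each
cusp inertia group `I_x ⊆ Δ^tp_X` is identified, as a topological group, with `Ẑ`, then every `I_x`
contains an INFINITE compact totally disconnected pro-`Σ` subgroup `Q` (`Σ` the datum's nonempty set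
of primes; `Q :=` the pro-`l` part of `I_x`, `l ∈ Σ`) — literally the per-cusp datum `hPx` consumed
downstream ([IUTchII] Cor. 2.4 (i) input (A):
`Literature.IUT.HodgeArakelov.PlusMinusTower.StableCurveAgreement.inputA1_of_proSigmaPart` /
`h25_piV_of_proSigmaPart(_of_prop24iii)`, abc-iut-w5-d121). [cite: Mochizuki2012, Cor 2.5 p.51] -/
theorem proSigmaPart_of_equiv_zHat (e : ∀ x : D.Cusp, ↥(D.inertiaTp x) ≃ₜ* ZHat) :
    ∀ x : D.Cusp, ∃ Q : Subgroup D.DeltaTp, Q ≤ D.inertiaTp x ∧ IsCompact (Q : Set D.DeltaTp) ∧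
      (Q : Set D.DeltaTp).Infinite ∧ IsProSigma D.graph.Sigma Q ∧ TotallyDisconnectedSpace Q := by
  intro x
  obtain ⟨l, hl⟩ := D.graph.sigma_nonempty
  have hlp : l.Prime := D.graph.sigmaHat_prime l (D.graph.sigma_subset hl)
  obtain ⟨P, hc, hinf, hS⟩ := exists_infinite_compact_proSigma_of_continuousMulEquiv (e x)
    (zHat_exists_infinite_compact_proSigma hlp hl)
  haveI hItd : TotallyDisconnectedSpace ↥(D.inertiaTp x) :=
    totallyDisconnectedSpace_of_continuous_injective' (e x).continuous (e x).injective
  refine ⟨P.map (D.inertiaTp x).subtype, Subgroup.map_subtype_le _, ?_, ?_, ?_, ?_⟩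
  · rw [Subgroup.coe_map]
    exact hc.image continuous_subtype_val
  · rw [Subgroup.coe_map]
    exact hinf.image (Subgroup.subtype_injective _).injOn
  · refine isProSigma_of_surjective hS
      (Subgroup.equivMapOfInjective P (D.inertiaTp x).subtype
        (Subgroup.subtype_injective _)).toMonoidHom ?_
      (Subgroup.equivMapOfInjective P _ _).surjective
    refine continuous_induced_rng.2 ?_
    exact (continuous_subtype_val.comp continuous_subtype_val).congr fun _ => rfl
  · have hle : (P.map (D.inertiaTp x).subtype : Set D.DeltaTp) ⊆ (D.inertiaTp x : Set D.DeltaTp) :=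
      fun v hv => Subgroup.map_subtype_le _ hv
    exact totallyDisconnectedSpace_of_continuous_injective' (continuous_inclusion hle)
      (Set.inclusion_injective hle)

/-- The sub-DAG node `HasCompactProSigma` (an infinite profinite pro-`Σ` compact subgroup
`V ⊆ Δ^tp_X`) holds as soon as some cusp inertia group `I_x ⊆ Δ^tp_X` is identified, as a
topological group, with `Ẑ` — by the pro-`l` part of `I_x`, `l ∈ Σ`.
[cite: Mochizuki2012, Prop 2.4(iii) p.51] -/
theorem hasCompactProSigma_of_equiv_zHat {x : D.Cusp} (e : ↥(D.inertiaTp x) ≃ₜ* ZHat) :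
    D.HasCompactProSigma :=
  D.proSigmaSylowAtom_of_equiv_zHat e

/-- **Prop. 2.4 (iii) from the tower of Prop. 2.4 (i) and a cusp with `I_x ≅ Ẑ(1)`**: the sub-DAG
capstone `Prop24Tower.prop24iii_of_tower` with its pro-`Σ` Sylow input supplied by
`hasCompactProSigma_of_equiv_zHat`. [cite: Mochizuki2012, Prop 2.4(iii) p.51] -/
theorem Prop24Tower.prop24iii_of_tower_of_equiv_zHat {D : StableCurveTemperedData.{u}}
    (T : D.Prop24Tower) [T2Space D.PiTp] (hc : T.LevelsClosed) (h21 : T.Prop21Levels)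
    (hL2 : T.LevelsDetect) (hL3 : T.Translate) (hINV : T.DetectsTempered) {x : D.Cusp}
    (e : ↥(D.inertiaTp x) ≃ₜ* ZHat) : D.Prop24iii :=
  T.prop24iii_of_tower hc h21 hL2 hL3 hINV (D.hasCompactProSigma_of_equiv_zHat e)

end StableCurveTemperedData

end Literature.IUT.HodgeTheaters
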